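import Literature.Analysis.FluidPDE.NashGeometricLemma
import Literature.Analysis.FluidPDE.CLCutoffs
import Literature.Analysis.FunctionSpaces.TorusSpaceTimeComposition
import HarnessLib

/-!
# Cheskidov–Luo convex integration: the stress cut-off `ρ` and the amplitude cores `â_x`

Analysis/FluidPDE support file (all results proved; definitions are explicit constructions) for
the proof of Prop. 4.1 of A. Cheskidov, X. Luo, *Sharp nonuniqueness for the Navier–Stokes
equations*, Invent. Math. 229 (2022) = arXiv:2009.06596, §4.3–§4.4 (numbering of the held arXiv
copy).

CL22 set `ρ = χ(R̄)` with `χ` a smooth proxy of `max(1, |·|)` and `a_k = θ g_κ(νt) ρ^{1/2} Γ_k(Id - R̄/ρ)`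
(§4.3 (4.13), §4.4 (4.15)). As recorded in `NashGeometricLemma` (reviewer note) and in the plan of
this series, two repairs are needed for the printed choice: a *floor* `γ₀ > 0` (so that
`∫ρ ≲ ‖R̄‖_{L¹} + γ₀`, used in Prop. 5.3, is true for small `R̄(t)`) and a factor making
`|R̄/ρ| ≤ r_d` land in the ball where the geometric lemma applies. Here, for a stress field
`R : ℝ → 𝕋^d → (d → ℝ^d)` (by columns, entry `(i, j)` is `R t y j i`) and a floor `γ₀ > 0`:

* `frobSq R t y = ∑ᵢⱼ R_{ij}²` (squared Frobenius norm);
* `divisor γ₀ R t y = (2γ₀/r_d) F(frobSq/γ₀²)` with `F = CL22.divisorProfile` (`F = 1` on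
  `(-∞,1]`, `F(s) = √s` on `[4,∞)`, `√s ≤ 2F(s)`), so `ρ := divisor` satisfies `ρ ≥ 2γ₀/r_d`,
  `|R|_F ≤ r_d ρ`, `ρ ≤ (2/r_d)(|R|_F + γ₀)` (`le_divisor`, `sqrt_frobSq_le`, `divisor_le`);
* `stressMatrix γ₀ R t y = Id - R/ρ` (a point of `d → d → ℝ`, in the closed sup-ball
  `B̄(Id, r_d)`, `dist_stressMatrix_le`);
* `amp γ₀ R x t y = ρ^{1/2} Γ_x(Id - R/ρ)` — the `λ`-free core `â_x` of CL22's amplitude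
  `a_x = θ(t) g_x(νt) â_x` (`Γ_x = NashGeometric.coeff x`, directions `k_x = NashGeometric.dir x`).

Main facts: the **pointwise key identity** `∑_x â_x² (k_x)ᵢ(k_x)ⱼ = ρ δᵢⱼ - Rᵢⱼ` for symmetric
`R(t, y)` (`sum_amp_sq_mul_dir`; CL22 Lemma 4.4 without the time factors, from
`NashGeometric.decomposition`), the bounds `0 ≤ â_x`, `â_x² ≤ ρ`, and joint smoothness of `ρ`,
`ρ^{1/2}`, `Id - R/ρ`, `â_x` on any time set on which `R` is jointly smooth (`Γ_x` is smooth on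
the open ball `B(Id, 2r_d) ⊃ B̄(Id, r_d)`).

## References

* A. Cheskidov, X. Luo, arXiv:2009.06596, §4.1 Lemma 4.2, §4.3 (4.12)–(4.13), §4.4 (4.15),
  Lemma 4.4. [`CheskidovLuo2022`]
-/

noncomputable section

open Set Metric Finset
open scoped ContDiff

namespace Literature.Analysis.FluidPDE

namespace CL22

open Literature.Analysis.FunctionSpaces NashGeometric

variable {d : Type*} [Fintype d] [DecidableEq d]

/-! ## Definitions -/

section Defs

variable (γ₀ : ℝ) (R : ℝ → UnitAddTorus d → d → EuclideanSpace ℝ d)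

omit [DecidableEq d] in
/-- The squared Frobenius norm `|R(t,y)|_F² = ∑ᵢⱼ R_{ij}(t,y)²` of a stress field stored by
columns. [folklore] -/
def frobSq (t : ℝ) (y : UnitAddTorus d) : ℝ := ∑ i, ∑ j, (R t y j i) ^ 2

/-- **The stress cut-off** `ρ(t,y) = (2γ₀/r_d) F(|R(t,y)|_F²/γ₀²)` with floor `γ₀` (CL22, §4.3
(4.13): `ρ = χ(R̄)`; here with the floor and the factor `2/r_d` that make `Id - R/ρ ∈ B̄(Id, r_d)`
and `ρ ≲ |R| + γ₀`, see the file header). [cite: CheskidovLuo2022, §4.3 (4.13)] -/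
def divisor (t : ℝ) (y : UnitAddTorus d) : ℝ :=
  (2 * γ₀ / radius d) * divisorProfile (frobSq R t y / γ₀ ^ 2)

/-- The matrix `Id - R(t,y)/ρ(t,y)` fed to the geometric lemma (CL22, §4.4 (4.15): the argument
`Id - R̄/ρ` of `Γ_k`), as a point of `d → d → ℝ` (entry `(i, j)` uses `R t y j i`). [cite: CheskidovLuo2022, §4.4 (4.15)] -/
def stressMatrix (t : ℝ) (y : UnitAddTorus d) : d → d → ℝ :=
  fun i j => (idMat : d → d → ℝ) i j - R t y j i / divisor γ₀ R t y

/-- **The amplitude core** `â_x(t,y) = ρ^{1/2} Γ_x(Id - R/ρ)` (CL22, §4.4 (4.15) without the time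
factors `θ(t) g_κ(νt)`). [cite: CheskidovLuo2022, §4.4 (4.15)] -/
def amp (x : Index d) (t : ℝ) (y : UnitAddTorus d) : ℝ :=
  Real.sqrt (divisor γ₀ R t y) * coeff x (stressMatrix γ₀ R t y)

end Defs

variable {γ₀ : ℝ} {R : ℝ → UnitAddTorus d → d → EuclideanSpace ℝ d}

/-! ## Pointwise bounds -/

section Bounds

omit [DecidableEq d] in
/-- `0 ≤ |R|_F²`. [folklore] -/
theorem frobSq_nonneg (t : ℝ) (y : UnitAddTorus d) : 0 ≤ frobSq R t y :=
  sum_nonneg fun _ _ => sum_nonneg fun _ _ => sq_nonneg _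

omit [DecidableEq d] in
/-- Each entry is bounded by the Frobenius norm: `|R_{ij}| ≤ |R|_F`. [folklore] -/
theorem abs_apply_le_sqrt_frobSq (t : ℝ) (y : UnitAddTorus d) (i j : d) :
    |R t y j i| ≤ Real.sqrt (frobSq R t y) := by
  refine Real.abs_le_sqrt ?_
  calc (R t y j i) ^ 2 ≤ ∑ j', (R t y j' i) ^ 2 :=
        single_le_sum (f := fun j' => (R t y j' i) ^ 2) (fun _ _ => sq_nonneg _) (mem_univ j)
    _ ≤ frobSq R t y := single_le_sum (f := fun i' => ∑ j', (R t y j' i') ^ 2)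
        (fun _ _ => sum_nonneg fun _ _ => sq_nonneg _) (mem_univ i)

omit [DecidableEq d] in
/-- The Frobenius norm is bounded by `#d` times the column-sup norm: `|R|_F ≤ #d · ‖R(t,y)‖`. [folklore] -/
theorem sqrt_frobSq_le_card_mul_norm (t : ℝ) (y : UnitAddTorus d) :
    Real.sqrt (frobSq R t y) ≤ Fintype.card d * ‖R t y‖ := by
  have h0 : 0 ≤ (Fintype.card d : ℝ) * ‖R t y‖ := by positivity
  rw [Real.sqrt_le_left h0]
  have hentry : ∀ i j, (R t y j i) ^ 2 ≤ ‖R t y‖ ^ 2 := fun i j => by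
    rw [← sq_abs]
    refine pow_le_pow_left₀ (abs_nonneg _) ?_ 2
    exact ((Real.norm_eq_abs _).symm.le.trans (PiLp.norm_apply_le (R t y j) i)).trans (norm_le_pi_norm (R t y) j)
  calc frobSq R t y ≤ ∑ _i : d, ∑ _j : d, ‖R t y‖ ^ 2 := sum_le_sum fun i _ => sum_le_sum fun j _ => hentry i j
    _ = (Fintype.card d : ℝ) ^ 2 * ‖R t y‖ ^ 2 := by
        rw [sum_const, sum_const, card_univ, nsmul_eq_mul, nsmul_eq_mul]; ring
    _ = ((Fintype.card d : ℝ) * ‖R t y‖) ^ 2 := by ring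

variable (hd : 2 ≤ Fintype.card d) (hγ : 0 < γ₀)
include hd hγ

omit [DecidableEq d] in
/-- `ρ > 0`. [folklore] -/
theorem divisor_pos (t : ℝ) (y : UnitAddTorus d) : 0 < divisor γ₀ R t y :=
  mul_pos (div_pos (by linarith) (radius_pos hd)) (lt_of_lt_of_le one_pos (one_le_divisorProfile _))

omit [DecidableEq d] in
/-- **The floor**: `2γ₀/r_d ≤ ρ`. [folklore] -/
theorem le_divisor (t : ℝ) (y : UnitAddTorus d) : 2 * γ₀ / radius d ≤ divisor γ₀ R t y :=
  le_mul_of_one_le_right (div_pos (by linarith) (radius_pos hd)).le (one_le_divisorProfile _)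

omit [DecidableEq d] in
/-- **`|R|_F ≤ r_d ρ`** (from `√s ≤ 2F(s)`). [folklore] -/
theorem sqrt_frobSq_le (t : ℝ) (y : UnitAddTorus d) :
    Real.sqrt (frobSq R t y) ≤ radius d * divisor γ₀ R t y := by
  have hr := radius_pos hd
  have h := sqrt_le_two_mul_divisorProfile (frobSq R t y / γ₀ ^ 2)
  rw [Real.sqrt_div (frobSq_nonneg t y), Real.sqrt_sq hγ.le, div_le_iff₀ hγ] at h
  calc Real.sqrt (frobSq R t y) ≤ 2 * divisorProfile (frobSq R t y / γ₀ ^ 2) * γ₀ := h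
    _ = radius d * divisor γ₀ R t y := by unfold divisor; field_simp

omit [DecidableEq d] in
/-- **`ρ ≤ (2/r_d)(|R|_F + γ₀)`** (from `F(s) ≤ 1 + √s`). [folklore] -/
theorem divisor_le (t : ℝ) (y : UnitAddTorus d) :
    divisor γ₀ R t y ≤ (2 / radius d) * (Real.sqrt (frobSq R t y) + γ₀) := by
  have hr := radius_pos hd
  have h := divisorProfile_le (frobSq R t y / γ₀ ^ 2)
  rw [Real.sqrt_div (frobSq_nonneg t y), Real.sqrt_sq hγ.le] at h
  unfold divisor
  calc 2 * γ₀ / radius d * divisorProfile (frobSq R t y / γ₀ ^ 2)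
      ≤ 2 * γ₀ / radius d * (1 + Real.sqrt (frobSq R t y) / γ₀) :=
        mul_le_mul_of_nonneg_left h (div_pos (by linarith) hr).le
    _ = (2 / radius d) * (Real.sqrt (frobSq R t y) + γ₀) := by field_simp; ring

omit [DecidableEq d] in
/-- **`ρ ≤ (2/r_d)(#d ‖R(t,y)‖ + γ₀)`** (column-sup norm). [folklore] -/
theorem divisor_le_norm (t : ℝ) (y : UnitAddTorus d) :
    divisor γ₀ R t y ≤ (2 / radius d) * (Fintype.card d * ‖R t y‖ + γ₀) := by
  have h2 : (0 : ℝ) ≤ 2 / radius d := (div_pos two_pos (radius_pos hd)).le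
  have h3 := sqrt_frobSq_le_card_mul_norm (R := R) t y
  refine (divisor_le hd hγ t y).trans (mul_le_mul_of_nonneg_left ?_ h2)
  linarith

omit [DecidableEq d] in
/-- Entries of `R/ρ` are at most `r_d`: `|R_{ij}|/ρ ≤ r_d`. [folklore] -/
theorem abs_apply_div_divisor_le (t : ℝ) (y : UnitAddTorus d) (i j : d) :
    |R t y j i / divisor γ₀ R t y| ≤ radius d := by
  have hρ := divisor_pos (R := R) hd hγ t y
  rw [abs_div, abs_of_pos hρ, div_le_iff₀ hρ]
  exact (abs_apply_le_sqrt_frobSq t y i j).trans (sqrt_frobSq_le hd hγ t y)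

/-- **`Id - R/ρ ∈ B̄(Id, r_d)`** (sup distance on `d → d → ℝ`), the closed ball on which the
geometric lemma (`NashGeometric.decomposition`, `le_coeff_sq`) applies (CL22, §4.4: "`Id - R̄/ρ`
lies in the domain of `Γ_k`"). [cite: CheskidovLuo2022, §4.4 (4.15)] -/
theorem dist_stressMatrix_le (t : ℝ) (y : UnitAddTorus d) :
    dist (stressMatrix γ₀ R t y) (idMat : d → d → ℝ) ≤ radius d := by
  refine (dist_pi_le_iff (radius_pos hd).le).2 fun i => (dist_pi_le_iff (radius_pos hd).le).2 fun j => ?_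
  rw [Real.dist_eq, stressMatrix, sub_sub_cancel_left, abs_neg]
  exact abs_apply_div_divisor_le hd hγ t y i j

omit hd hγ in
/-- `Id - R/ρ` is symmetric where `R` is. [folklore] -/
theorem stressMatrix_symm {t : ℝ} {y : UnitAddTorus d} (hsym : ∀ i j, R t y i j = R t y j i) (i j : d) :
    stressMatrix γ₀ R t y i j = stressMatrix γ₀ R t y j i := by
  simp only [stressMatrix, idMat, hsym j i]
  by_cases h : i = j
  · subst h; rfl
  · rw [if_neg h, if_neg (Ne.symm h)]

/-- The squared coefficients are at most `1` on `B̄(Id, r_d)` (`r_d ≤ 1/5`):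
`M_ii - 1/2 ≤ 1/2 + r_d`, `r_d/4 ± M_ij/8 ≤ r_d/4 + r_d/8`. [folklore] -/
theorem coeffSq_stressMatrix_le_one (x : Index d) (t : ℝ) (y : UnitAddTorus d) :
    coeffSq (stressMatrix γ₀ R t y) x ≤ 1 := by
  have hr := radius_le hd
  have hM := dist_stressMatrix_le (R := R) hd hγ t y
  rcases x with i | ⟨⟨i, j⟩, hij⟩ | ⟨⟨i, j⟩, hij⟩
  · have h := abs_sub_idMat_le hM i i
    rw [idMat_apply_self] at h
    have := (abs_le.mp h).2
    simp only [coeffSq_inl]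
    linarith
  · dsimp only at hij
    have h := abs_sub_idMat_le hM i j
    rw [idMat_apply_of_ne hij, sub_zero] at h
    have := (abs_le.mp h).2
    simp only [coeffSq_inr_inl]
    linarith
  · dsimp only at hij
    have h := abs_sub_idMat_le hM i j
    rw [idMat_apply_of_ne hij, sub_zero] at h
    have := (abs_le.mp h).1
    simp only [coeffSq_inr_inr]
    linarith

omit hd hγ in
/-- `0 ≤ â_x`. [folklore] -/
theorem amp_nonneg (x : Index d) (t : ℝ) (y : UnitAddTorus d) : 0 ≤ amp γ₀ R x t y :=
  mul_nonneg (Real.sqrt_nonneg _) (Real.sqrt_nonneg _)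

/-- `â_x² = ρ Γ_x(Id - R/ρ)²` with the affine `Γ_x²` of the geometric lemma. [folklore] -/
theorem amp_sq (x : Index d) (t : ℝ) (y : UnitAddTorus d) :
    amp γ₀ R x t y ^ 2 = divisor γ₀ R t y * coeffSq (stressMatrix γ₀ R t y) x := by
  rw [amp, mul_pow, Real.sq_sqrt (divisor_pos hd hγ t y).le,
    coeff_sq hd ((dist_stressMatrix_le hd hγ t y).trans (by linarith [radius_pos hd])) x]

/-- **`â_x² ≤ ρ`**. [folklore] -/
theorem amp_sq_le (x : Index d) (t : ℝ) (y : UnitAddTorus d) : amp γ₀ R x t y ^ 2 ≤ divisor γ₀ R t y := by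
  rw [amp_sq hd hγ]
  exact mul_le_of_le_one_right (divisor_pos hd hγ t y).le (coeffSq_stressMatrix_le_one hd hγ x t y)

/-- `â_x ≤ ρ^{1/2}`. [folklore] -/
theorem amp_le_sqrt (x : Index d) (t : ℝ) (y : UnitAddTorus d) :
    amp γ₀ R x t y ≤ Real.sqrt (divisor γ₀ R t y) := by
  have h := Real.abs_le_sqrt (amp_sq_le (R := R) hd hγ x t y)
  rwa [abs_of_nonneg (amp_nonneg x t y)] at h

/-- **The pointwise key identity** (CL22, Lemma 4.4 without the time factors):
`∑_x â_x(t,y)² (k_x)ᵢ (k_x)ⱼ = ρ(t,y) δᵢⱼ - Rᵢⱼ(t,y)` for symmetric `R(t,y)`, from the rank-one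
decomposition `Id - R/ρ = ∑_x Γ_x(Id - R/ρ)² k_x ⊗ k_x` of the geometric lemma on `B̄(Id, r_d)`.
[cite: CheskidovLuo2022, §4.4 Lemma 4.4] -/
theorem sum_amp_sq_mul_dir {t : ℝ} {y : UnitAddTorus d} (hsym : ∀ i j, R t y i j = R t y j i) (i j : d) :
    ∑ x, amp γ₀ R x t y ^ 2 * (((dir x i : ℤ) : ℝ) * ((dir x j : ℤ) : ℝ)) =
      divisor γ₀ R t y * (if i = j then 1 else 0) - R t y j i := by
  have hρ := divisor_pos (R := R) hd hγ t y
  have hM := dist_stressMatrix_le (R := R) hd hγ t y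
  have hdec := decomposition hd (stressMatrix_symm hsym) (hM.trans (by linarith [radius_pos hd])) i j
  simp_rw [amp_sq hd hγ, mul_assoc, ← mul_sum]
  have h2 : ∑ x, coeffSq (stressMatrix γ₀ R t y) x * (((dir x i : ℤ) : ℝ) * ((dir x j : ℤ) : ℝ)) =
      stressMatrix γ₀ R t y i j := by
    rw [hdec]
    exact sum_congr rfl fun x _ => by rw [coeff_sq hd (hM.trans (by linarith [radius_pos hd])) x]
  rw [h2, stressMatrix, idMat, mul_sub, mul_div_cancel₀ _ hρ.ne']

end Bounds

/-! ## Joint smoothness -/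

section Smooth

variable {S : Set ℝ}

omit [DecidableEq d] in
/-- Entries of a jointly smooth tensor field are jointly smooth. [folklore] -/
theorem isSmoothSpaceTimeOn_apply_apply (hR : Torus.IsSmoothSpaceTimeOn S R) (i j : d) :
    Torus.IsSmoothSpaceTimeOn S (fun t y => R t y j i) :=
  (hR.clm_comp (ContinuousLinearMap.proj (R := ℝ) (φ := fun _ : d => EuclideanSpace ℝ d) j)).apply i

omit [DecidableEq d] in
/-- `|R|_F²` is jointly smooth where `R` is. [folklore] -/
theorem isSmoothSpaceTimeOn_frobSq (hR : Torus.IsSmoothSpaceTimeOn S R) :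
    Torus.IsSmoothSpaceTimeOn S (frobSq R) := by
  have h : ∀ i j, Torus.IsSmoothSpaceTimeOn S (fun t y => (R t y j i) ^ 2) := fun i j => by
    have h1 := isSmoothSpaceTimeOn_apply_apply hR i j
    simpa only [sq] using h1.mul h1
  exact Torus.IsSmoothSpaceTimeOn.sum (s := univ) fun i _ =>
    Torus.IsSmoothSpaceTimeOn.sum (s := univ) fun j _ => h i j

variable (hd : 2 ≤ Fintype.card d) (hγ : 0 < γ₀)
include hd hγ

omit [DecidableEq d] hd hγ in
/-- **`ρ` is jointly smooth** where `R` is (`F ∈ C^∞`). [cite: CheskidovLuo2022, §4.3 (4.13)] -/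
theorem isSmoothSpaceTimeOn_divisor (hR : Torus.IsSmoothSpaceTimeOn S R) :
    Torus.IsSmoothSpaceTimeOn S (divisor γ₀ R) := by
  have h1 : Torus.IsSmoothSpaceTimeOn S (fun t y => frobSq R t y / γ₀ ^ 2) :=
    (isSmoothSpaceTimeOn_frobSq hR).mul (Torus.isSmoothSpaceTimeOn_const (Torus.isSmooth_const _) S)
  have h2 := (h1.comp_contDiff contDiff_divisorProfile).const_smul (2 * γ₀ / radius d)
  exact h2

omit [DecidableEq d] in
/-- `ρ^{1/2}` is jointly smooth (`ρ > 0`). [folklore] -/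
theorem isSmoothSpaceTimeOn_sqrt_divisor (hR : Torus.IsSmoothSpaceTimeOn S R) :
    Torus.IsSmoothSpaceTimeOn S (fun t y => Real.sqrt (divisor γ₀ R t y)) :=
  (isSmoothSpaceTimeOn_divisor hR).sqrt fun t _ y => divisor_pos hd hγ t y

/-- `Id - R/ρ` is jointly smooth as a field with values in `d → d → ℝ`. [folklore] -/
theorem isSmoothSpaceTimeOn_stressMatrix (hR : Torus.IsSmoothSpaceTimeOn S R) :
    Torus.IsSmoothSpaceTimeOn S (stressMatrix γ₀ R) := by
  refine Torus.isSmoothSpaceTimeOn_pi.2 fun i => Torus.isSmoothSpaceTimeOn_pi.2 fun j => ?_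
  have hρ := isSmoothSpaceTimeOn_divisor (γ₀ := γ₀) hR
  have hdiv : Torus.IsSmoothSpaceTimeOn S (fun t y => R t y j i / divisor γ₀ R t y) :=
    ContDiffOn.div (isSmoothSpaceTimeOn_apply_apply hR i j) hρ fun z _ => (divisor_pos hd hγ _ _).ne'
  exact (Torus.isSmoothSpaceTimeOn_const (Torus.isSmooth_const ((idMat : d → d → ℝ) i j)) S).sub hdiv

/-- **`â_x` is jointly smooth** where `R` is: `ρ^{1/2}` is smooth since `ρ > 0`, and
`Γ_x ∈ C^∞(B(Id, 2r_d))` is composed with `Id - R/ρ ∈ B̄(Id, r_d)` (CL22, §4.4: "`a_k` is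
smooth on `[0,1] × 𝕋^d`"). [cite: CheskidovLuo2022, §4.4 (4.15)] -/
theorem isSmoothSpaceTimeOn_amp (hR : Torus.IsSmoothSpaceTimeOn S R) (x : Index d) :
    Torus.IsSmoothSpaceTimeOn S (amp γ₀ R x) := by
  have hc : Torus.IsSmoothSpaceTimeOn S (fun t y => coeff x (stressMatrix γ₀ R t y)) :=
    (isSmoothSpaceTimeOn_stressMatrix hd hγ hR).comp_contDiffOn (contDiffOn_coeff hd x) fun t _ y =>
      mem_ball.2 ((dist_stressMatrix_le hd hγ t y).trans_lt (by linarith [radius_pos hd]))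
  exact (isSmoothSpaceTimeOn_sqrt_divisor hd hγ hR).mul hc

end Smooth

end CL22

end Literature.Analysis.FluidPDE
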